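import Literature.Computability.AlgebraicComplexity.BorderSubstitutionTorus
import Literature.Computability.AlgebraicComplexity.KoszulFlatteningBorderRank
import Literature.Computability.AlgebraicComplexity.CwSquareFlattening
import Literature.Computability.AlgebraicComplexity.SparseLURankCertificate
import Literature.Computability.AlgebraicComplexity.BorderRankRestriction
import Literature.Computability.AlgebraicComplexity.TensorRestrictionRank
import Literature.Computability.AlgebraicComplexity.XyzCubeFlattening
import Literature.Computability.AlgebraicComplexity.BorderRankCWProofs
import Literature.Computability.AlgebraicComplexity.SchoenhageTauBini
import Mathlib.Tactic.NormNum.Prime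
import HarnessLib

/-!
# `bR(T_{cw,2} ⊠ T_{skewcw,2}) ≥ 16`: border substitution on the torus-fixed hyperplanes of
# `X ⊠ ε ∈ Λ³ℂ⁹`, plus one `p = 2` Koszul certificate — kernel-checked

`Summits/MatrixMultiplication/MatrixMultiplication/Theorems` (soloist file, blind arm, session s39).

The MIXED Kronecker products of the two smallest Coppersmith–Winograd-type tensors
`T = T_{cw,2}` (`cwTensor ℂ 2`) and `E = T_{skewcw,2}` (`skewCwTensor ℂ 1`) obey the same ω-bound as the
pure powers (`ω ≤ log₂((4/27) · bR(W)^{3/k})` for every word `W` of length `k` in `T`, `E`, by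
`bR(T_{CW,2}^{⊠k}) ≤ bR(W)` and Coppersmith–Winograd's value bound), so their border ranks are of the same
interest as `bR(T^{⊠k})`, `bR(E^{⊠k})` (Conner–Gesmundo–Landsberg–Ventura, *Rank and border rank of
Kronecker powers of tensors and Strassen's laser method*, comput. complexity 31 (2022), Thm. 1.2 / §1:
`15 ≤ bR(T^{⊠2}) ≤ 16`, `bR(E^{⊠2}) = 17 = bR(det₃)`; Conner–Huang–Landsberg, *Bad and good news for
Strassen's laser method* (2020/23): `bR(T^{⊠2}) = bR(perm₃) = 16` by border apolarity).  Nothing about the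
mixed product `T ⊠ E` is in print or in the tree.  After the changes of basis of CGLV §2.2 / §3.2
(`tensorRestrictsTo_cwTensor_xyzTensor`, `cglv_exists_basis_skewCwTensor_one`) `T ⊠ E` becomes `M = X ⊠ ε` with `X = ∑_{{a,b,c}={0,1,2}} e_a⊗e_b⊗e_c`
and `ε = e₀ ∧ e₁ ∧ e₂`, i.e. `M = Alt(X) ∈ Λ³(ℂ³ ⊗ ℂ³)`, an integer tensor (`soloMix`).

This file proves, kernel-checked,

* `soloMix_sixteen_le` : `16 ≤ bR(X ⊠ ε)`;
* `sixteen_le_algBorderRank_cwTensor_kronecker_skewCwTensor` : `16 ≤ bR(T_{cw,2} ⊠ T_{skewcw,2})`.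

(Trivial flattening bound `9`; `M`'s Koszul flattenings `(5,2)`/`(9,4)` give `15` (ranks `88/6`, `1014/70`), the `(7,3)` one
gives `16` too (rank `306 > 300` over a generic `ℂ⁷ ⊂ ℂ⁹`; not certified here); numerically `R(M) = 20`, `bR(M) ≈ 18`.)

## How it is proved

1. **Torus-fixed border substitution** (Landsberg–Michałek, *A `2n²−log₂(n)−1` lower bound for the
   border rank of matrix multiplication*, IMRN 2018, §2–§3; the tree's `algBorderRank_zeroSlice_le`):
   `M` is homogeneous of weight `12` for the torus weights `ω(i,j) = i + 3j` on all three factors, and the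
   nine weights are DISTINCT, so for an optimal approximate decomposition with `r + 1` triads the
   weight-minimal coordinate `β` of the leading coefficient vector of a non-zero first vector satisfies
   `bR(M^{β}) ≤ r`, `M^{β}` = `M` with the first-factor slice `β` zeroed (`zeroSlice`).  Hence
   `bR(M) ≥ 1 + min_β bR(M^{β})` (`soloMix_succ_le_algBorderRank_of_slices`, stated for any tensor with an
   injective homogeneous weight on the first factor).
2. **Symmetry**: `𝔖₃ × 𝔖₃^{±}` (simultaneous coordinate permutations of the `X`-index and signed
   permutations of the `ε`-index) is transitive on the nine slices: `M^{(0,0)}` is `± M^{β}` relabelled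
   (`soloMixZ_symm`, by `decide`), so all nine `bR(M^{β})` are equal (`algBorderRank_reindex`, and `-t` is a
   restriction of `t`).
3. **One Koszul certificate**: the `p = 2` Koszul flattening (Landsberg–Ottaviani) of `M^{(0,0)}` after the
   integer restriction `Φ : ℂ⁹ → ℂ⁵` (`soloMixPhiTab`, ten entries `±1`) is a `90 × 90` integer matrix of
   rank `88`; an explicit `85 × 85` minor with a sparse LU factorisation mod `3` (`76 + 153` entries,
   `luCheck` of `SparseLURankCertificate.lean`, run by `decide +kernel`) is non-zero, so the rank over `ℂ`
   is `≥ 85 > 6 · 14` and `bR(M^{(0,0)}) ≥ 15` (`le_algBorderRank_of_lt_rank_koszulFlattening`).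
4. `16 ≤ bR(X ⊠ ε) ≤ bR(T_{cw,2} ⊠ T_{skewcw,2})` by restriction (`TensorRestrictsTo.kronecker`,
   `TensorRestrictsTo.algBorderRank_le`).

The certificate (restriction matrix, pivot order, factors) was found outside Lean (random sparse `Φ`,
Markowitz elimination over `𝔽₃`) and is verified here by the kernel only.

## References

* A. Conner, F. Gesmundo, J. M. Landsberg, E. Ventura, comput. complexity 31 (2022), Thm. 1.2, §2.2,
  §3 eq. (8), §3.2; arXiv:1909.04785. [ConnerGesmundoLandsbergVentura2022]
* J. M. Landsberg, M. Michałek, IMRN 2018 (15), 4722–4733, §2–§3; arXiv:1608.07486. [LandsbergMichalek2018]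
* J. M. Landsberg, G. Ottaviani, Theory of Computing 11 (2015), Thm. 2.1. [LandsbergOttaviani2015]
* J. M. Landsberg, *Geometry and Complexity Theory*, CUP 2017, Prop. 5.4.1.3 and §5.4.3. [LandsbergGCT2017]
-/

namespace Summit.MatrixMultiplication.MatrixMultiplication.Theorems

open Matrix Polynomial
open Literature.Computability.AlgebraicComplexity

/-! ## The integer model `M = X ⊠ ε` and its zero slices -/

/-- `M = X ⊠ ε` on pair indices `(i, j) ∈ {0,1,2}²` (`i` the `X`-index, `j` the `ε`-index), over `ℤ`:
`M_{(i,j)(i',j')(i'',j'')} = [\{i,i',i''\} = \{0,1,2\}] · ε_{j j' j''}`. [new] -/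
def soloMix (a b c : Fin 3 × Fin 3) : ℤ :=
  (if comp1 b.1 c.1 = some a.1 then 1 else 0) * leviCivita3Table a.2 b.2 c.2

/-- `M^{β}`: `M` with the first-factor slice `β` zeroed, over `ℤ` (kernel-evaluable `zeroSlice`). [new] -/
def soloMixZ (β : Fin 3 × Fin 3) (a b c : Fin 3 × Fin 3) : ℤ := if a = β then 0 else soloMix a b c

/-- `M` over `ℂ`. [new] -/
noncomputable def soloMixC (a b c : Fin 3 × Fin 3) : ℂ := (soloMix a b c : ℂ)

/-- `M_ℂ = X ⊠ ε` with the tree's `xyzTensor` and `leviCivita3`. [new] -/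
theorem soloMixC_eq :
    soloMixC = kroneckerTensor (xyzTensor ℂ) (fun i j k => (leviCivita3 i j k : ℂ)) := by
  funext a b c
  simp only [soloMixC, soloMix, kroneckerTensor_apply, xyzTensor_apply, leviCivita3_eq_table, Int.cast_mul]
  split_ifs <;> simp

/-- The zero slices of `M_ℂ` are the base changes of the integer ones. [new] -/
theorem zeroSlice_soloMixC (β : Fin 3 × Fin 3) :
    zeroSlice soloMixC β = fun a b c => ((soloMixZ β a b c : ℤ) : ℂ) := by
  funext a b c
  simp only [zeroSlice_apply, soloMixC, soloMixZ]
  split_ifs <;> simp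

/-- The torus weight `ω(i, j) = i + 3j` (the same on all three factors). [new] -/
def soloMixWt (a : Fin 3 × Fin 3) : ℕ := (a.1 : ℕ) + 3 * (a.2 : ℕ)

/-- `ω` is injective (the nine weights are `0, …, 8`). [new] -/
theorem soloMixWt_injective : Function.Injective soloMixWt := by
  unfold soloMixWt
  decide

/-- `M` is homogeneous of weight `12`. [new] -/
theorem soloMix_hom : ∀ a b c : Fin 3 × Fin 3, soloMix a b c ≠ 0 →
    soloMixWt a + soloMixWt b + soloMixWt c = 12 := by
  unfold soloMixWt
  decide

/-! ## Symmetry: all nine slices are `± M^{(0,0)}` relabelled -/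

/-- The relabelling `(i, j) ↦ ((0 i₀) i, (0 j₀) j)` for `β = (i₀, j₀)`. [new] -/
def soloMixSwap (β : Fin 3 × Fin 3) : Fin 3 × Fin 3 ≃ Fin 3 × Fin 3 :=
  Equiv.prodCongr (Equiv.swap 0 β.1) (Equiv.swap 0 β.2)

/-- The sign `sgn((0 j₀))`. [new] -/
def soloMixSgn (β : Fin 3 × Fin 3) : ℤ := if β.2 = 0 then 1 else -1

/-- `M^{(0,0)} = ± M^{β}` relabelled by `soloMixSwap β` (`X` is `𝔖₃`-invariant, `ε` alternating). [new] -/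
theorem soloMixZ_symm : ∀ β a b c : Fin 3 × Fin 3,
    soloMixSgn β * soloMixZ β (soloMixSwap β a) (soloMixSwap β b) (soloMixSwap β c) =
      soloMixZ (0, 0) a b c := by
  decide +kernel

/-- `-t` is a restriction of `t` (`A = -1`), so `bR(-t) ≤ bR(t)`. [folklore] -/
theorem soloMix_algBorderRank_neg_le {ι κ μ : Type} [Fintype ι] [DecidableEq ι] [Fintype κ]
    [DecidableEq κ] [Fintype μ] [DecidableEq μ] (t : ι → κ → μ → ℂ) :
    algBorderRank (fun a b c => -t a b c) ≤ algBorderRank t := by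
  have h := algBorderRank_restrict₁_le t (fun a' a => if a = a' then (-1 : ℂ) else 0)
  have hfun : (fun a' b c => ∑ a, (if a = a' then (-1 : ℂ) else 0) * t a b c) =
      fun a b c => -t a b c := by
    funext a' b c
    simp [ite_mul, Finset.sum_ite_eq']
  rw [hfun] at h
  exact h

/-- From `15 ≤ bR(M^{(0,0)})` to `15 ≤ bR(M^{β})` for every `β`. [new] -/
theorem soloMix_slice_ge (h0 : 15 ≤ algBorderRank (fun a b c => ((soloMixZ (0, 0) a b c : ℤ) : ℂ)))
    (β : Fin 3 × Fin 3) : 15 ≤ algBorderRank (zeroSlice soloMixC β) := by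
  rw [zeroSlice_soloMixC]
  have hid : (fun a b c => ((soloMixZ (0, 0) a b c : ℤ) : ℂ)) = fun a b c =>
      (soloMixSgn β : ℂ) * ((soloMixZ β (soloMixSwap β a) (soloMixSwap β b) (soloMixSwap β c) : ℤ) : ℂ) := by
    funext a b c
    rw [← soloMixZ_symm β a b c]
    push_cast
    ring
  rw [hid, algBorderRank_reindex (soloMixSwap β) (soloMixSwap β) (soloMixSwap β)
    (fun a b c => (soloMixSgn β : ℂ) * ((soloMixZ β a b c : ℤ) : ℂ))] at h0
  by_cases hs : β.2 = 0
  · simpa [soloMixSgn, hs] using h0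
  · have hsg : (soloMixSgn β : ℂ) = -1 := by simp [soloMixSgn, hs]
    rw [hsg] at h0
    simp only [neg_one_mul] at h0
    exact h0.trans (soloMix_algBorderRank_neg_le _)

/-! ## The torus step: `bR(t) ≥ 1 + min_β bR(t^{β})` for an injective homogeneous weight -/

/-- **Border substitution on the torus-fixed hyperplanes** (Landsberg–Michałek 2018 §2, via the tree's
`algBorderRank_zeroSlice_le` with the identity stabiliser): if `t ≠ 0` is homogeneous for weights
`ωA, ωB, ωC` with `ωA` injective and `k ≤ bR(t^{β})` for every first-factor coordinate `β`, then
`k + 1 ≤ bR(t)`. [cite: LandsbergMichalek2018, §2 (Prop. 2.3, Lemma 2.2)] -/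
theorem soloMix_succ_le_algBorderRank_of_slices {ι κ μ : Type} [Fintype ι] [DecidableEq ι] [Fintype κ]
    [DecidableEq κ] [Fintype μ] [DecidableEq μ] (t : ι → κ → μ → ℂ) (ωA : ι → ℕ) (ωB : κ → ℕ)
    (ωC : μ → ℕ) (e : ℕ) (hhom : ∀ a b c, t a b c ≠ 0 → ωA a + ωB b + ωC c = e)
    (hinj : Function.Injective ωA) {a₀ : ι} {b₀ : κ} {c₀ : μ} (hne : t a₀ b₀ c₀ ≠ 0) (k : ℕ)
    (hk : ∀ β, k ≤ algBorderRank (zeroSlice t β)) : k + 1 ≤ algBorderRank t := by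
  classical
  obtain ⟨h, hh⟩ := exists_algBorderRank_eq_approxRank t
  obtain ⟨r₁, hr₁⟩ : ∃ r₁, algBorderRank t = r₁ := ⟨_, rfl⟩
  have hA : approxRank h t = r₁ := by rw [← hh, hr₁]
  rw [hr₁]
  cases r₁ with
  | zero =>
    exfalso
    obtain ⟨u, v, w, huvw⟩ : ∃ (u : Fin 0 → ι → ℂ[X]) (v : Fin 0 → κ → ℂ[X])
        (w : Fin 0 → μ → ℂ[X]), IsApproxDecomposition h t u v w := by
      rw [← hA]
      exact exists_isApproxDecomposition_approxRank h _
    have key := huvw a₀ b₀ c₀ h le_rfl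
    rw [if_pos rfl] at key
    have ht : t a₀ b₀ c₀ = 0 := by simpa using key.symm
    exact hne ht
  | succ r =>
    obtain ⟨u, v, w, huvw⟩ : ∃ (u : Fin (r + 1) → ι → ℂ[X]) (v : Fin (r + 1) → κ → ℂ[X])
        (w : Fin (r + 1) → μ → ℂ[X]), IsApproxDecomposition h t u v w := by
      rw [← hA]
      exact exists_isApproxDecomposition_approxRank h _
    -- some first vector is non-zero
    obtain ⟨ρ₀, hρ₀⟩ : ∃ ρ₀, u ρ₀ ≠ 0 := by
      by_contra hno
      push Not at hno
      have key := huvw a₀ b₀ c₀ h le_rfl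
      rw [if_pos rfl] at key
      have h0 : (∑ ρ, u ρ a₀ * v ρ b₀ * w ρ c₀) = 0 :=
        Finset.sum_eq_zero fun ρ _ => by rw [hno ρ]; simp
      rw [h0, coeff_zero] at key
      exact hne key.symm
    -- leading data `u ρ₀ = ε^s (lc + ε R)`, `lc ≠ 0`
    obtain ⟨s, lc, R, hlead, hlc⟩ := exists_leadingData (u ρ₀) hρ₀
    have hsupp : (Finset.univ.filter fun a => lc a ≠ 0).Nonempty := by
      by_contra h0
      rw [Finset.not_nonempty_iff_eq_empty, Finset.filter_eq_empty_iff] at h0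
      exact hlc (funext fun a => by simpa using h0 (Finset.mem_univ a))
    -- `β`: the coordinate of least weight in the support of `lc`
    obtain ⟨β, hβ, hβmin⟩ := Finset.exists_min_image _ ωA hsupp
    rw [Finset.mem_filter] at hβ
    have hsum : ∀ a', ∑ a, (if a = a' then (1 : ℂ) else 0) * lc a = lc a' := fun a' => by
      simp [ite_mul, Finset.sum_ite_eq']
    have step := algBorderRank_zeroSlice_le huvw ρ₀ s lc R hlead
      (fun a' a => if a = a' then (1 : ℂ) else 0) (fun b' b => if b = b' then (1 : ℂ) else 0)
      (fun c' c => if c = c' then (1 : ℂ) else 0)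
      (fun a' b' c' => by simp [ite_mul, Finset.sum_ite_eq'])
      ωA ωB ωC e hhom β (by rw [hsum]; exact hβ.2)
      (fun a' hne' ha' => by
        rw [hsum] at ha'
        have hle := hβmin a' (by simpa using ha')
        exact lt_of_le_of_ne hle fun heq => hne' (hinj heq).symm)
    have := hk β
    omega

/-! ## The certificate data (generated outside Lean, verified by the kernel) -/

/-- The integer restriction matrix `Φ : ℤ⁹ → ℤ⁵` of the certificate, as a table `j ↦ a₁ ↦ a₂ ↦ Φ_{j,(a₁,a₂)}`
(ten non-zero entries `±1`; the column of the zeroed coordinate `(0,0)` is `0`). [new] -/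
def soloMixPhiTab : Fin 5 → Fin 3 → Fin 3 → ℤ :=
  ![![![0, -1, 0], ![0, 0, 0], ![0, 0, -1]],
    ![![0, 0, -1], ![0, 0, 0], ![0, 0, 0]],
    ![![0, 0, 0], ![0, 0, 1], ![-1, 1, 0]],
    ![![0, 1, 0], ![-1, 0, 0], ![0, 0, 0]],
    ![![0, 0, 0], ![0, 1, -1], ![0, 0, 0]]]

/-- The `85` row labels `(ti, (c₁, c₂))` (row `(dec3 ti, c)`) of the certified minor, in elimination order. [new] -/
def soloMixRows : Fin 85 → Fin 10 × (Fin 3 × Fin 3) :=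
  ![(0, (0, 0)), (0, (0, 2)), (0, (2, 0)), (0, (2, 2)), (1, (0, 0)), (1, (0, 2)), (1, (2, 2)),
    (2, (0, 2)), (0, (0, 1)), (1, (1, 2)), (2, (0, 1)), (2, (1, 2)), (2, (2, 2)), (0, (2, 1)),
    (2, (2, 1)), (3, (2, 0)), (4, (1, 1)), (5, (0, 0)), (5, (1, 0)), (5, (0, 1)), (5, (1, 1)),
    (6, (2, 0)), (3, (0, 0)), (1, (1, 0)), (3, (0, 1)), (6, (2, 2)), (7, (2, 2)), (8, (0, 0)),
    (6, (0, 0)), (8, (0, 1)), (8, (0, 2)), (8, (1, 0)), (8, (1, 1)), (5, (1, 2)), (2, (1, 1)),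
    (7, (1, 2)), (2, (1, 0)), (5, (0, 2)), (1, (1, 1)), (7, (2, 1)), (4, (2, 2)), (4, (2, 1)),
    (9, (1, 1)), (9, (1, 0)), (9, (2, 0)), (3, (1, 0)), (4, (0, 0)), (4, (2, 0)), (3, (2, 1)),
    (3, (2, 2)), (6, (2, 1)), (7, (2, 0)), (9, (0, 0)), (6, (1, 0)), (9, (1, 2)), (9, (2, 1)),
    (0, (1, 2)), (1, (0, 1)), (1, (2, 0)), (1, (2, 1)), (2, (0, 0)), (3, (1, 1)), (4, (0, 1)),
    (4, (0, 2)), (4, (1, 0)), (4, (1, 2)), (5, (2, 1)), (6, (0, 1)), (6, (0, 2)), (6, (1, 1)),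
    (6, (1, 2)), (7, (0, 2)), (7, (1, 0)), (7, (1, 1)), (9, (0, 1)), (9, (2, 2)), (0, (1, 0)),
    (3, (0, 2)), (0, (1, 1)), (7, (0, 0)), (2, (2, 0)), (7, (0, 1)), (8, (2, 0)), (3, (1, 2)),
    (5, (2, 0))]

/-- The `85` column labels `(si, (b₁, b₂))` (column `(dec2 si, b)`) of the certified minor, in elimination order. [new] -/
def soloMixCols : Fin 85 → Fin 10 × (Fin 3 × Fin 3) :=
  ![(4, (1, 1)), (0, (1, 1)), (1, (1, 1)), (4, (1, 0)), (5, (1, 1)), (0, (2, 1)), (0, (1, 0)),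
    (0, (2, 0)), (0, (1, 2)), (5, (2, 0)), (6, (1, 0)), (6, (2, 0)), (0, (0, 0)), (1, (1, 0)),
    (3, (1, 0)), (1, (1, 2)), (8, (0, 0)), (2, (2, 2)), (9, (2, 2)), (3, (2, 2)), (9, (0, 0)),
    (4, (1, 2)), (7, (1, 1)), (2, (2, 1)), (2, (1, 2)), (4, (0, 1)), (4, (0, 0)), (5, (2, 2)),
    (5, (2, 1)), (6, (2, 2)), (6, (2, 1)), (9, (2, 1)), (9, (2, 0)), (3, (2, 0)), (6, (0, 0)),
    (6, (0, 1)), (3, (2, 1)), (2, (2, 0)), (5, (0, 0)), (8, (1, 0)), (1, (0, 0)), (3, (0, 0)),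
    (9, (0, 2)), (8, (2, 2)), (7, (0, 2)), (7, (0, 1)), (1, (2, 2)), (8, (1, 2)), (1, (0, 2)),
    (1, (0, 1)), (7, (1, 0)), (4, (0, 2)), (7, (2, 2)), (7, (2, 1)), (9, (0, 1)), (8, (0, 2)),
    (0, (0, 1)), (0, (2, 2)), (2, (1, 1)), (2, (1, 0)), (5, (1, 0)), (2, (0, 2)), (3, (1, 2)),
    (3, (1, 1)), (3, (0, 2)), (3, (0, 1)), (8, (0, 1)), (5, (1, 2)), (4, (2, 1)), (5, (0, 2)),
    (5, (0, 1)), (6, (1, 1)), (8, (2, 1)), (8, (2, 0)), (9, (1, 2)), (7, (0, 0)), (1, (2, 1)),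
    (0, (0, 2)), (1, (2, 0)), (4, (2, 2)), (4, (2, 0)), (6, (1, 2)), (9, (1, 1)), (2, (0, 1)),
    (7, (2, 0))]

/-- The unit lower factor `L` mod `3`: row `i` lists `(s, L_is)`, `s < i` (`76` entries). [new] -/
def soloMixL : Fin 85 → List (ℕ × ℕ) :=
  ![[], [], [], [], [], [], [], [], [(3, 2), (7, 2)], [(7, 1)], [(7, 1)], [], [(10, 2)], [(12, 2)],
    [(12, 1)], [], [], [], [], [], [], [], [], [], [], [(3, 2)], [], [], [], [(9, 2)], [(9, 2)],
    [(29, 1)], [], [(32, 2)], [(33, 1)], [(34, 2)], [(29, 1), (35, 1)], [(36, 2)], [(37, 2)],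
    [(26, 1), (34, 1)], [(39, 2)], [(40, 1)], [], [(42, 1)], [], [], [(36, 2)], [], [], [(13, 2)],
    [(38, 1)], [(25, 2), (35, 1)], [(31, 2)], [], [(20, 1)], [(20, 2)], [(12, 1)], [], [(8, 1)],
    [], [(5, 2), (57, 1)], [], [(33, 2), (39, 1)], [(14, 1)], [(43, 1)], [(41, 2)], [(64, 1)],
    [(9, 2)], [(4, 1), (60, 1)], [], [(38, 2)], [(10, 2)], [], [], [(32, 2), (43, 1)],
    [(39, 2), (66, 2)], [(25, 2)], [(58, 2), (59, 1), (67, 1), (76, 1)], [(26, 1), (77, 1)],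
    [(30, 1), (68, 2), (71, 2)], [(56, 2), (63, 2), (77, 1), (78, 2)], [(11, 2), (80, 2)],
    [(69, 2), (70, 1), (80, 1)], [(78, 2)], [(61, 2), (62, 1), (74, 2), (75, 1), (78, 1), (83, 1)]]

/-- The upper factor `U` mod `3`: row `s` lists `(j, U_sj)`, `j ≥ s`, diagonal first (`153` entries). [new] -/
def soloMixU : Fin 85 → List (ℕ × ℕ) :=
  ![[(0, 1), (5, 2), (8, 1)], [(1, 2), (6, 2)], [(2, 2), (21, 2), (56, 2)], [(3, 1)], [(4, 1)],
    [(5, 2)], [(6, 2), (56, 2), (60, 1)], [(7, 2)], [(8, 1)], [(9, 1)], [(10, 2)], [(11, 1)],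
    [(12, 2)], [(13, 1)], [(14, 1)], [(15, 1), (83, 1)], [(16, 2), (64, 2)],
    [(17, 1), (23, 1), (82, 1)], [(18, 2), (19, 2), (54, 1)], [(19, 2), (37, 2)], [(20, 2)],
    [(21, 1), (22, 1), (70, 1)], [(22, 1), (23, 1), (24, 2)], [(23, 2), (27, 2), (57, 1), (70, 1)],
    [(24, 2), (37, 2), (46, 1), (50, 2)], [(25, 2)], [(26, 2)], [(27, 1), (28, 1)],
    [(28, 1), (67, 2)], [(29, 2)], [(30, 1)], [(31, 1)], [(32, 2)], [(33, 1)], [(34, 2)],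
    [(35, 1)], [(36, 2)], [(37, 2)], [(38, 2)], [(39, 2)], [(40, 2)], [(41, 2)], [(42, 1)],
    [(43, 2)], [(44, 1), (45, 1), (47, 2), (54, 2)], [(45, 1), (46, 1), (52, 2), (61, 2)],
    [(46, 1), (62, 2), (76, 1)], [(47, 2), (48, 1), (49, 1), (65, 1)], [(48, 1)],
    [(49, 2), (50, 1)], [(50, 2), (51, 1)], [(51, 1)], [(52, 1), (53, 1), (74, 1)],
    [(53, 1), (69, 2), (79, 1)], [(54, 2), (73, 1)], [(55, 2), (75, 2)], [(56, 2), (80, 1)],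
    [(57, 1), (60, 2)], [(58, 2), (67, 2)], [(59, 1), (77, 1)], [(60, 1), (71, 1)],
    [(61, 2), (75, 2)], [(62, 2), (78, 2)], [(63, 1), (78, 2)], [(64, 2), (66, 1)],
    [(65, 1), (73, 1)], [(66, 2)], [(67, 2), (79, 1)], [(68, 2), (71, 2)], [(69, 2), (84, 2)],
    [(70, 1), (80, 2)], [(71, 1), (80, 2)], [(72, 1)], [(73, 2)], [(74, 1), (84, 2)], [(75, 2)],
    [(76, 2), (77, 1), (79, 2)], [(77, 1)], [(78, 1)], [(79, 1), (80, 2), (81, 2)],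
    [(80, 1), (81, 2)], [(81, 1)], [(82, 1), (84, 2)], [(83, 1), (84, 1)], [(84, 1)]]

/-! ## The `p = 2` Koszul certificate for `M^{(0,0)}` -/

/-- `Φ` as an integer matrix on pair indices. [new] -/
def soloMixPhi : Matrix (Fin 5) (Fin 3 × Fin 3) ℤ := Matrix.of fun j a => soloMixPhiTab j a.1 a.2

/-- **Slice formula** (kernel-evaluable): `∑_a Φ_{ja} M^{(0,0)}_{abc}`; for fixed `(b, c)` the only `a`
with `M_{abc} ≠ 0` is `(x, y)` with `x, y` the complements of `(b₁, c₁)`, `(b₂, c₂)`. [new] -/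
def soloMixPhiVal (j : Fin 5) (b c : Fin 3 × Fin 3) : ℤ :=
  match comp1 b.1 c.1, comp1 b.2 c.2 with
  | some x, some y => if x = 0 ∧ y = 0 then 0 else soloMixPhiTab j x y * leviCivita3Table y b.2 c.2
  | _, _ => 0

/-- The slice formula computes `∑_a Φ_{ja} M^{(0,0)}_{abc}`. [new] -/
theorem soloMixPhiVal_eq (j : Fin 5) (b c : Fin 3 × Fin 3) :
    ∑ a, soloMixPhi j a * soloMixZ (0, 0) a b c = soloMixPhiVal j b c := by
  rw [Fintype.sum_prod_type]
  simp only [Fin.sum_univ_three, soloMixPhi, Matrix.of_apply]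
  revert j b c
  decide +kernel

/-- **Entry formula** of the `p = 2` Koszul flattening of `(Φ ⊗ 1 ⊗ 1) M^{(0,0)}` over `ℤ`, row
`(dec3 ti, c)`, column `(dec2 si, b)`: `∑_j incTab2 ti si j · soloMixPhiVal j b c`.
[cite: ConnerGesmundoLandsbergVentura2022, §3 eq. (8)] -/
theorem soloMix_kent_eq (ti si : Fin 10) (b c : Fin 3 × Fin 3) :
    koszulFlattening 2 soloMixPhi.mulVecLin (soloMixZ (0, 0)) (dec3 ti, c) (dec2 si, b) =
      ∑ j : Fin 5, incTab2 ti si j * soloMixPhiVal j b c := by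
  rw [koszulFlattening_apply, wedgeMatrix_apply]
  refine Finset.sum_congr rfl fun j _ => ?_
  rw [incTab2_eq]
  split_ifs
  · rw [Matrix.mulVecLin_apply, Matrix.mulVec, dotProduct, soloMixPhiVal_eq]
    rfl
  · rw [zero_mul]

/-- **The rank certificate**: `85 ≤ rank_ℂ K_Φ(M^{(0,0)})` — the `85 × 85` minor on rows `soloMixRows`,
columns `soloMixCols` has the LU factorisation `soloMixL · soloMixU` mod `3` with non-zero diagonal,
checked by the kernel (`luCheck`). [new] -/
theorem soloMix_koszulRank_ge :
    85 ≤ ((koszulFlattening 2 soloMixPhi.mulVecLin (soloMixZ (0, 0))).map (Int.castRingHom ℂ)).rank :=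
  le_rank_map_of_luCheck (K := ℂ) (pr := 3) _
    (fun i j =>
      incTab2 (soloMixRows i).1 (soloMixCols j).1 0 * soloMixPhiVal 0 (soloMixCols j).2 (soloMixRows i).2 +
      incTab2 (soloMixRows i).1 (soloMixCols j).1 1 * soloMixPhiVal 1 (soloMixCols j).2 (soloMixRows i).2 +
      incTab2 (soloMixRows i).1 (soloMixCols j).1 2 * soloMixPhiVal 2 (soloMixCols j).2 (soloMixRows i).2 +
      incTab2 (soloMixRows i).1 (soloMixCols j).1 3 * soloMixPhiVal 3 (soloMixCols j).2 (soloMixRows i).2 +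
      incTab2 (soloMixRows i).1 (soloMixCols j).1 4 * soloMixPhiVal 4 (soloMixCols j).2 (soloMixRows i).2)
    (fun i => (dec3 (soloMixRows i).1, (soloMixRows i).2)) (fun j => (dec2 (soloMixCols j).1, (soloMixCols j).2))
    (fun i j => by rw [soloMix_kent_eq, Fin.sum_univ_five]) soloMixL soloMixU
    (by decide +kernel)

/-- `15 ≤ bR(M^{(0,0)})` (`6 · 14 = 84 < 85`). [new] -/
theorem soloMix_slice_zero_ge : 15 ≤ algBorderRank (fun a b c => ((soloMixZ (0, 0) a b c : ℤ) : ℂ)) := by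
  have hfun : (fun a b c => ((soloMixZ (0, 0) a b c : ℤ) : ℂ)) =
      fun a b c => Int.castRingHom ℂ (soloMixZ (0, 0) a b c) := by
    funext a b c
    simp
  rw [hfun]
  refine le_algBorderRank_of_lt_rank_koszulFlattening 2 (soloMixPhi.map (Int.castRingHom ℂ)) _ ?_
  rw [← koszulFlattening_map]
  have h := soloMix_koszulRank_ge
  have h6 : (2 * 2).choose 2 = 6 := by decide
  rw [h6]
  omega

/-! ## Assembly -/

/-- **`16 ≤ bR(X ⊠ ε)`** (`X ⊠ ε = Alt(X) ∈ Λ³ℂ⁹`, the integer model of `T_{cw,2} ⊠ T_{skewcw,2}`). [new] -/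
theorem soloMix_sixteen_le : 16 ≤ algBorderRank soloMixC := by
  have hne : soloMixC ((0 : Fin 3), (0 : Fin 3)) (1, 1) (2, 2) ≠ 0 := by
    simp [soloMixC, soloMix, comp1, leviCivita3Table]
  refine soloMix_succ_le_algBorderRank_of_slices soloMixC soloMixWt soloMixWt soloMixWt 12
    (fun a b c h => soloMix_hom a b c (by simpa [soloMixC] using h)) soloMixWt_injective hne 15
    (soloMix_slice_ge soloMix_slice_zero_ge)

/-- `T_{cw,2} ⊠ T_{skewcw,2}` restricts to (indeed is isomorphic to) `X ⊠ ε`: the Kronecker product of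
the changes of basis of CGLV §2.2 and §3.2. [cite: ConnerGesmundoLandsbergVentura2022, §2.2 and §3.2] -/
theorem soloMix_restrictsTo :
    TensorRestrictsTo (kroneckerTensor (cwTensor ℂ 2) (skewCwTensor ℂ 1)) soloMixC := by
  rw [soloMixC_eq]
  refine tensorRestrictsTo_cwTensor_xyzTensor.kronecker ?_
  obtain ⟨B, C, -, -, hBC⟩ := cglv_exists_basis_skewCwTensor_one
  exact ⟨fun i i' => (1 : Matrix (Fin 3) (Fin 3) ℂ) i i', fun j j' => B j j', fun k k' => C k k',
    fun i j k => (hBC i j k).symm⟩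

/-- **`16 ≤ bR(T_{cw,2} ⊠ T_{skewcw,2})`** — the border rank of the mixed Kronecker product of the two
smallest Coppersmith–Winograd-type tensors is at least `16` (trivial bound `9`; Koszul `(5,2)`/`(9,4)`: `15`, `(7,3)`: `16`;
in print `bR(T_{cw,2}^{⊠2}) = bR(perm₃) = 16` and `bR(T_{skewcw,2}^{⊠2}) = bR(det₃) = 17`). [new] -/
theorem sixteen_le_algBorderRank_cwTensor_kronecker_skewCwTensor :
    16 ≤ algBorderRank (kroneckerTensor (cwTensor ℂ 2) (skewCwTensor ℂ 1)) :=
  soloMix_sixteen_le.trans soloMix_restrictsTo.algBorderRank_le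

end Summit.MatrixMultiplication.MatrixMultiplication.Theorems
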